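import Summits.AtomisticToContinuum.FouriersLaw.Theses.ContactStieltjesMeasure
import Literature.MathematicalPhysics.KineticTheory.LangevinChainReversal
import Literature.MathematicalPhysics.KineticTheory.LangevinChainExpMartingale
import Literature.MathematicalPhysics.KineticTheory.LangevinChainGibbs

/-!
# Sketch for crux idea `heat-reversal` (ideator k4, gen 6) — stmt-AtomisticToContinuum-15248

Lever: the two-temperature GENERALIZED DETAILED BALANCE of the Langevin chain — the tree's time-reversed
(anti-damped) kernel `P̂_t = langevinRevKernel` is, after the momentum flip `Θ`, the PHYSICAL kernel reweighted
by the exponential of the entropy production `Σ_t = Q_L(t)/T_L + Q_R(t)/T_R`: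
`e^{2γt} P̂_t(y, A) = E_{Θy}[e^{Σ_t} ; ΘX_t ∈ A]` (`HeatReversalDuality`, Girsanov with density
`e^{Σ_t - 2γt}`; Rey-Bellet–Thomas 2002 Lemma 2.5 / Remark 2.6 in the Langevin-bath model).  With the
tree's Lebesgue duality `dx P_t(x,dy) = e^{2γt} dy P̂_t(y,dx)` the NESS density obeys
`h(y) = E_{Θy}[e^{Σ_t} h(ΘX_t)]`, and stopping at the first entrance of an energy sublevel set `K = {H ≤ E}`
(energy balance `Q_L + Q_R = H(X_t) - H(X_0)`) gives the pointwise bound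
`h_δ(y) ≤ C_K · e^{-(H(y)-E)/T_L} · E_{Θy}[exp(θ Q_R(τ_K))]`, `θ = 1/T_R - 1/T_L`.
Residual `C⁺` (generator form): a positive supersolution of the `θ Q_R`-tilted backward operator outside `K`
with sub-Gibbs growth (`TiltedSupersolution`) ⇒ `δ`-uniform Gibbs(T_hot) domination of the steady family
(`GibbsHotDomination`) ⇒ tightness ⇒ (k4g3 / k4-0 transfer) `Phi4Edge` ⇒ crux (p167063).
-/

noncomputable section

open MeasureTheory Filter Set
open scoped Topology ContDiff NNReal ENNReal
open Literature.MathematicalPhysics.KineticTheory.HeatConduction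
open Literature.Probability.Process

namespace Summit.AtomisticToContinuum.FouriersLaw.Cruxes.StieltjesRepresentation.IdeasK4g6

/-- Heat received from the bath acting on site `i` up to time `t` along the pathwise flow `chainFlow x η`:
the `i`-th summand of `OscillatorChain.noiseWork` (work of the noise component `η_i`) minus the `i`-th
summand of `OscillatorChain.dissipation` (`γ w_i ∫₀ᵗ p_i²`).  `∑_i siteHeat = noiseWork - dissipation =
H(z_t) - H(x)` (`pinnedChain_hamiltonian_chainFlow_eq`). -/
def siteHeat (P : OscillatorChain) (N : ℕ) (x : PhaseSpace N) (η : ℝ → Fin N → ℝ) (t : ℝ) (i : Fin N) : ℝ :=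
  (((P.chainFlow N x η t).2 i - η t i) * η t i -
      (∫ s in (0 : ℝ)..t, η s i * (P.drift N (P.chainFlow N x η s)).2 i) + η t i ^ 2 / 2) -
    P.γ * ∫ s in (0 : ℝ)..t, OscillatorChain.bathWeight N i * (P.chainFlow N x η s).2 i ^ 2

/-- The entropy-production functional `Σ_t = Q_L(t)/T_L + Q_R(t)/T_R` of a path started at `x` and driven
by the pair of Brownian paths `w` (bath amplitudes `√(2γT_L), √(2γT_R)` as in `OscillatorChain.pairNoise`). -/
def heatForm (P : OscillatorChain) (N : ℕ) (T_L T_R : ℝ) (x : PhaseSpace N) (w : WienerPair) (t : ℝ) : ℝ :=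
  ∑ i : Fin N, ((if i.val = 0 then 1 / T_L else 0) + (if i.val = N - 1 then 1 / T_R else 0)) *
    siteHeat P N x (P.pairNoise N T_L T_R w) t i

/-- **FIRST LEMMA — heat-weighted time reversal (two-temperature generalized detailed balance).**
For the pinned chain between Langevin baths, the time-reversed kernel of the tree
(`OscillatorChain.langevinRevKernel`: reversed Hamiltonian flow, anti-friction `+γ p_b`) is the momentum
flip of the PHYSICAL kernel reweighted by `e^{Σ_t}`:  `e^{2γt} P̂_t(y, A) = E_{Θy}[e^{Σ_t} ; ΘX_t ∈ A]`.
(Girsanov: flipping momenta turns `-Y` into the Hamiltonian field with anti-friction; the density of the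
anti-damped law w.r.t. the damped one on `F_t` is `exp(∑_b (Q_b(t) - γT_b t)/T_b) = e^{Σ_t - 2γt}`.)
Combined with the tree's Lebesgue duality `compProd_langevinKernel_eq` this is
`dx P_t(x, dy) = dy · E_{Θy}[e^{Σ_t} ; X_t ∈ Θdx]`. -/
def HeatReversalDuality : Prop :=
  ∀ ω₂ lam β γ : ℝ, 0 < ω₂ → 0 ≤ lam → 0 ≤ β → 0 < γ → ∀ N : ℕ, 2 ≤ N →
    ∀ T_L T_R : ℝ, 0 < T_L → 0 < T_R → ∀ t : ℝ≥0, 0 < t →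
      ∀ y : PhaseSpace N, ∀ A : Set (PhaseSpace N), MeasurableSet A →
        ENNReal.ofReal (Real.exp (2 * γ * (t : ℝ))) * (pinnedChain ω₂ lam β γ).langevinRevKernel N T_L T_R t y A =
          ∫⁻ w, ENNReal.ofReal (Real.exp
              (heatForm (pinnedChain ω₂ lam β γ) N T_L T_R (momentumReversal N y) (pairPath w) t)) *
            A.indicator (fun _ => (1 : ℝ≥0∞))
              (momentumReversal N ((pinnedChain ω₂ lam β γ).solMap N T_L T_R t (momentumReversal N y) (pairPath w)))
            ∂wienerPair

/-- The backward operator of the chain TILTED by `θ ·`(heat from the right bath): the Feynman–Kac–Girsanov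
generator of `u(t, y) = E_y[exp(θ Q_R(t)) f(X_t)]`,
`L^θ f = L f + γ·[2 θ T_R p_{N-1} ∂_{p_{N-1}} f + θ (T_R - (1 - θ T_R) p_{N-1}²) f]`
(`dQ_R = (γT_R - γ p²_{N-1}) dt + √(2γT_R) p_{N-1} dW_R`). -/
def coldTiltedGenerator (P : OscillatorChain) (N : ℕ) (T_L T_R θ : ℝ) (f : PhaseSpace N → ℝ)
    (x : PhaseSpace N) : ℝ :=
  P.generator N T_L T_R f x + P.γ * ∑ i : Fin N,
    (if i.val = N - 1 then 2 * θ * T_R * x.2 i * partialP i f x + θ * (T_R - (1 - θ * T_R) * x.2 i ^ 2) * f x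
      else 0)

/-- **C⁺ — FIRST-RETURN COLD-HEAT BOUND, generator form** (the single residual of the line).  On the `φ⁴`
edge, for `|δ| < δ₀` there is a positive `C²` supersolution `w` of the `θ`-tilted backward operator
(`θ = 1/T_R - 1/T_L`, `T_{L,R} = T ± δ/2`) OUTSIDE an energy sublevel set `{H ≤ E}`, `≥ 1` on it, of
sub-Gibbs growth `w ≤ C e^{εH}` with `ε < 1/T_hot` — constants uniform in `δ`.  By the minimal-solution
characterisation this is equivalent to the path statement
`E_y[exp(θ Q_R(τ_{H ≤ E}))] ≤ C e^{ε H(y)}`: the chain started anywhere draws at most `≈ ε T_R² H(y)/δ` net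
heat FROM the colder bath (exponential moment of order `θ ≈ δ/T²`) before its energy first returns to `E`. -/
def TiltedSupersolution : Prop :=
  ∀ ω₂ lam γ T : ℝ, 0 < ω₂ → 0 < lam → 0 < γ → 0 < T → ∀ N : ℕ, 2 ≤ N →
    ∃ E δ₀ C ε : ℝ, 0 < δ₀ ∧ δ₀ < T ∧ ε < 1 / (T + δ₀ / 2) ∧ ∀ δ : ℝ, |δ| < δ₀ →
      ∃ w : PhaseSpace N → ℝ, ContDiff ℝ 2 w ∧ (∀ x, 0 < w x) ∧
        (∀ x, (pinnedChain ω₂ lam 0 γ).hamiltonian N x ≤ E → 1 ≤ w x) ∧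
        (∀ x, w x ≤ C * Real.exp (ε * (pinnedChain ω₂ lam 0 γ).hamiltonian N x)) ∧
        ∀ x, E < (pinnedChain ω₂ lam 0 γ).hamiltonian N x →
          coldTiltedGenerator (pinnedChain ω₂ lam 0 γ) N (T + δ / 2) (T - δ / 2)
            (1 / (T - δ / 2) - 1 / (T + δ / 2)) w x ≤ 0

/-- **OUTPUT — `δ`-uniform Gibbs(T_hot) domination of the steady family on the `φ⁴` edge**: under weak-NESS
uniqueness, the steady states at `(T + δ/2, T - δ/2)`, `|δ| < δ₀`, are dominated setwise by ONE multiple of a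
sub-Gibbs density `C e^{-cH}`, `c > 0` — in particular the family is tight at `δ = 0` with exponential
energy moments. -/
def GibbsHotDomination : Prop :=
  ∀ ω₂ lam γ T : ℝ, 0 < ω₂ → 0 < lam → 0 < γ → 0 < T → ∀ N : ℕ, 2 ≤ N →
    (∀ T_L T_R : ℝ, 0 < T_L → 0 < T_R → ∀ ν ν' : Measure (PhaseSpace N),
      (pinnedChain ω₂ lam 0 γ).IsSteadyState N T_L T_R ν → (pinnedChain ω₂ lam 0 γ).IsSteadyState N T_L T_R ν' →
        ν = ν') →
    ∀ μ : ℝ → ℝ → Measure (PhaseSpace N),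
      (∀ T_L T_R : ℝ, 0 < T_L → 0 < T_R → (pinnedChain ω₂ lam 0 γ).IsSteadyState N T_L T_R (μ T_L T_R)) →
      ∃ δ₀ C c : ℝ, 0 < δ₀ ∧ 0 < c ∧ ∀ δ : ℝ, |δ| < δ₀ → ∀ A : Set (PhaseSpace N), MeasurableSet A →
        μ (T + δ / 2) (T - δ / 2) A ≤
          ENNReal.ofReal C * ∫⁻ x in A, ENNReal.ofReal (Real.exp (-(c * (pinnedChain ω₂ lam 0 γ).hamiltonian N x)))

/-- Tightness at `δ = 0` of a `δ`-indexed family of measures, by energy sublevel sets — VERBATIM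
`IdeasK4g3.TightAt` (that sketch module is not in the farm build, so it is restated here). -/
def TightAt (N : ℕ) (H : PhaseSpace N → ℝ) (ν : ℝ → Measure (PhaseSpace N)) : Prop :=
  ∀ ε : ℝ, 0 < ε → ∃ E δ₀ : ℝ, 0 < δ₀ ∧ ∀ δ : ℝ, |δ| < δ₀ → ν δ {x | E < H x} ≤ ENNReal.ofReal ε

/-- The `φ⁴`-edge clause of the crux — VERBATIM `Phi4Edge` = the right-hand side of
`CayleyPencil.stieltjesRepresentation_iff_phi4Edge` (p167063) = registered stub `stub_phi4Edge`. -/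
def Phi4Edge : Prop :=
  ∀ ω₂ lam : ℝ, 0 < ω₂ → 0 < lam → ∀ T : ℝ, 0 < T →
    ∃ Φ : ℕ → ℝ → ℝ, ∀ N : ℕ, 2 ≤ N → Monotone (Φ N) ∧ (∀ s : ℝ, s ≤ 0 → Φ N s = 0) ∧
      (∃ m : ℝ, ∀ s : ℝ, Φ N s ≤ m) ∧ ∀ γ : ℝ, 0 < γ →
        (∀ (N' : ℕ) (T_L T_R : ℝ), 0 < T_L → 0 < T_R → ∀ μ ν : Measure (PhaseSpace N'),
          (pinnedChain ω₂ lam 0 γ).IsSteadyState N' T_L T_R μ →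
          (pinnedChain ω₂ lam 0 γ).IsSteadyState N' T_L T_R ν → μ = ν) →
        ∀ μ : (N' : ℕ) → ℝ → ℝ → Measure (PhaseSpace N'),
          (∀ (N' : ℕ) (T_L T_R : ℝ), 0 < T_L → 0 < T_R →
            (pinnedChain ω₂ lam 0 γ).IsSteadyState N' T_L T_R (μ N' T_L T_R)) →
          Tendsto (fun δ : ℝ => (pinnedChain ω₂ lam 0 γ).totalCurrent (μ N (T + δ / 2) (T - δ / 2)) / δ)
            (𝓝[≠] 0)
            (𝓝 (((N : ℝ) - 1) * γ * ∫ t in Set.Ioi (0 : ℝ), Φ N t * (2 * t / (γ ^ 2 + t ^ 2) ^ 2)))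

/-- Tightness of the (unique) steady family at `δ = 0`, in the k4g3 currency `TightAt`. -/
def DominatedTightness : Prop :=
  ∀ ω₂ lam γ T : ℝ, 0 < ω₂ → 0 < lam → 0 < γ → 0 < T → ∀ N : ℕ, 2 ≤ N →
    (∀ T_L T_R : ℝ, 0 < T_L → 0 < T_R → ∀ ν ν' : Measure (PhaseSpace N),
      (pinnedChain ω₂ lam 0 γ).IsSteadyState N T_L T_R ν → (pinnedChain ω₂ lam 0 γ).IsSteadyState N T_L T_R ν' →
        ν = ν') →
    ∀ μ : ℝ → ℝ → Measure (PhaseSpace N),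
      (∀ T_L T_R : ℝ, 0 < T_L → 0 < T_R → (pinnedChain ω₂ lam 0 γ).IsSteadyState N T_L T_R (μ T_L T_R)) →
      TightAt N ((pinnedChain ω₂ lam 0 γ).hamiltonian N) (fun δ => μ (T + δ / 2) (T - δ / 2))

/-- **THE LINE'S THEOREM (representation + first entrance + comparison):** the residual gives domination.
Informal proof: `HeatReversalDuality` + Lebesgue duality ⇒ `h = e^{2γt} P̂_t h` ⇒
`h(y)·|K| = lim_t E_{Θy}[e^{Σ_t}; X_t ∈ K]` (positive Harris, from uniqueness) ⇒ strong Markov at `τ_K` and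
`e^{Σ_τ} = e^{(E - H(y))/T_L} e^{θ Q_R(τ)}` ⇒ `h(y) ≤ C_K e^{-(H(y)-E)/T_L} u_θ(Θy)`, and `u_θ ≤ w`
(supermartingale + Fatou, the supersolution `w` of `TiltedSupersolution`). -/
def HeatReversalDomination : Prop := TiltedSupersolution → GibbsHotDomination

/-- Domination ⇒ tightness (dominated convergence against `e^{-cH} ∈ L¹`, pinned `φ⁴`). -/
def DominationTightness : Prop := GibbsHotDomination → DominatedTightness

/-- Transfer to the edge clause: k4g3's `TightnessTransfer` / k4-0's `TightImpliesEdge` consume exactly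
tightness of the steady family at `δ = 0` (their proofs use only the given family). -/
def TightnessToEdge : Prop := DominatedTightness → Phi4Edge

/-- Composition of the line (the last step `Phi4Edge ↔ StieltjesRepresentation` is p167063). -/
theorem phi4Edge_of (h₁ : TiltedSupersolution) (h₂ : HeatReversalDomination) (h₃ : DominationTightness)
    (h₄ : TightnessToEdge) : Phi4Edge :=
  h₄ (h₃ (h₂ h₁))

/-- Sanity: the crux decl is in scope by name. -/
example : Prop := Summit.AtomisticToContinuum.FouriersLaw.Theses.ContactStieltjesMeasure.StieltjesRepresentation

end Summit.AtomisticToContinuum.FouriersLaw.Cruxes.StieltjesRepresentation.IdeasK4g6
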